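import Summits.Ventures.CertifiedManyBodySolver.Observables.PairLROTowerStationaryStep
import Literature.MathematicalPhysics.QuantumLattice.TranslationSumDoubleCommutator
import Literature.MathematicalPhysics.QuantumLattice.HubbardNNNHoppingRemovalCost
import HarnessLib

/-!
# OP1-S without the licence: the one-point / tower ceiling with EQUATION-OF-MOTION rows is sound
# unconditionally

HONEST FRAMING: first certified bounds on pairing observables; not a superconductivity verdict; a ceiling
route, never presence. Crew hubbard-obs (D-0042), seat hubbard-obs-p1 (`prover-hubbard-obs-p1-g6-0`).
Zero compute; no definition; no named fact; no `sorry`.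

`liminf_pairFieldLRO_le_sq_of_onePoint_variational_bound_TT'` (PairLROTowerCeiling) reads a one-point
bound (OP1) valid for EVERY unit vector `ζ` of every large torus — the soundness class OP1-E of the
gauge-broken reduced-density-matrix bootstrap (positivity + translations/point group + filling rows +
energy window), in which the stationarity rows `ω([H, X]) = 0` are NOT available (`ζ` is no
eigenvector). This file proves that they ARE available, at no cost in hypotheses: the (OP1) inequality
may carry the additional slack term `Re⟨ζ, [H_L, W_L] ζ⟩/L²`, `W_L = Σ_v T_v Γ_L(w)` the translation
sum of ANY number-conserving local word `w ∈ 𝔄_{Λ_w}` (`[N̂_{Λ_w}, w] = 0`) — i.e. the certificate may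
use the neutral equation-of-motion rows with arbitrary multipliers — and the conclusion
`liminf_k u_k ≤ M²` is unchanged (`liminf_pairFieldLRO_le_sq_of_onePoint_stationary_bound_TT'`).

Mechanism (finite volume, no chemical potential, no sector convexity — the "licence" of the earlier OP1-S
discussion is not needed):
1. every level `(Δ†)^m ψ_L/‖·‖` of the Koma–Tasaki tower witness has TOTAL energy `≤ E_N + O_k(1)`
   (PairLROTowerWitnessStationary) while the minimum of its own particle-number sector obeys
   `E_{N+2m} ≥ E_N − m·C_pair` (pair REMOVAL costs `O(1)`, HubbardNNNHoppingRemovalCost): excess `ε = O(1)`;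
2. finite-volume Pusz–Woronowicz / Bratteli–Kishimoto–Robinson (VariationalStationarity): a unit vector of
   excess `ε` over the floor of its sector has `‖⟨[H_L, W_L]⟩‖ ≤ √(2εD₁) + √(2εD₂)`, `D_i` the
   double-commutator constants of the Hermitian parts of `W_L`;
3. locality (TranslationSumDoubleCommutator): `D_i = O(L²)` for translation sums of local observables;
hence the slack is `O(L)·L⁻² = O(1/L) → 0` along the family, and the tower argument
(`tower_finite_step_S`, part 1) closes as before.

References: T. Koma, H. Tasaki, J. Stat. Phys. 76 (1994) 745, Theorem 5, §4 [KomaTasaki1994]; W. Pusz,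
S. L. Woronowicz, Comm. Math. Phys. 58 (1978) 273, §1 [PuszWoronowicz1978]; X. Han, arXiv:2006.06002,
§2–3 (equation-of-motion constraints `⟨[H, O]⟩ = 0`) [Han2020Bootstrap]; D. Ruelle, *Statistical
Mechanics* (1969) §3.4 [Ruelle1969].
-/

noncomputable section

namespace Summit.Ventures.CertifiedManyBodySolver.Observables

open Matrix Complex Finset Literature.MathematicalPhysics.QuantumLattice Literature.Probability.LatticeModels
open Literature.MathematicalPhysics.QuantumLattice.HubbardWave0 ThermodynamicLimit Filter Topology
open Literature.MathematicalPhysics.QuantumManyBody.StateRelaxation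
open scoped ComplexOrder ComplexConjugate BigOperators

/-! ### §3  Families of sector ground states: (OP1-S) ⇒ `liminf u_k ≤ M²` -/

section Family

variable (g : Site 2 → ℝ)

/-- **OP1-S is sound: a one-point bound valid up to an equation-of-motion slack still gives
`liminf_k u_k ≤ M²`.** Let `U ≥ 0`, `0 < n < 2`, `κ ≥ 0`, `e(t,t',U,n) ≤ u`, and let `w ∈ 𝔄_{Λ_w}` be any
local operator commuting with the particle number of its window (`[N̂_{Λ_w}, w] = 0`: e.g. any combination
of neutral ladder words — the equation-of-motion rows of the bootstrap with their multipliers). Suppose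
(OP1-S): for every side `L ≥ L₁` and every unit vector `ζ` of the torus,
`c − A + Σ_σ μ_σ(Re⟨ζ,N_σζ⟩/L² − ν) + κ(u − Re⟨ζ,H_Lζ⟩/L²) + Re⟨ζ, (H_L W_L − W_L H_L) ζ⟩/L² ≤ −Re⟨ζ,Δ_gζ⟩/L²`,
`W_L = Σ_v T_v Γ_L(w)`, `H_L = hubbardTorusTT' L t t' U`. Then every family of unit `(rectN n L, S^z=0)`-sector
ground states has `liminf_k u_k ≤ (c − A + (Σ_σ μ_σ)(n/2 − ν))²` — the conclusion of
`liminf_pairFieldLRO_le_sq_of_onePoint_variational_bound_TT'`, whose hypothesis is the case `w = 0`.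
The stationarity rows need NO chemical-potential or sector-convexity licence.
[cite: KomaTasaki1994, Theorem 5] [cite: PuszWoronowicz1978, §1] [cite: Han2020Bootstrap, §2–3] -/
theorem liminf_pairFieldLRO_le_sq_of_onePoint_stationary_bound_TT' (t t' : ℝ) {U n : ℝ} (hU : 0 ≤ U)
    (hn0 : 0 < n) (hn2 : n < 2) {c A κ u ν : ℝ} (μ : Fin 2 → ℝ) (hκ : 0 ≤ κ)
    (hu : energyDensityTT' t t' U n ≤ u)
    {Λw : Finset (Site 2)} (wloc : FermionOp Λw) (hwN : Commute totalNumberOp wloc) (L₁ : ℕ)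
    (hInjw : ∀ L : ℕ, L₁ ≤ L → Set.InjOn (Torus.proj (d := 2) L) ↑Λw)
    (hboundS : ∀ (L : ℕ) [NeZero L] (hL : L₁ ≤ L) (ζ : Fock (Orb (FermionTorus 2 L))), star ζ ⬝ᵥ ζ = 1 →
      c - A + ∑ σ : Fin 2, μ σ *
          ((star ζ ⬝ᵥ ((∑ y : FermionTorus 2 L, numberOp y σ) *ᵥ ζ)).re / (L : ℝ) ^ 2 - ν) +
        κ * (u - (star ζ ⬝ᵥ (hubbardTorusTT' L t t' U *ᵥ ζ)).re / (L : ℝ) ^ 2) +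
        (star ζ ⬝ᵥ ((hubbardTorusTT' L t t' U *
              (∑ v : TorusSite 2 L, relabel (Orb.translate v)
                (fermionEmbed (PolySite.toTorusEmb L (hInjw L hL)) wloc)) -
            (∑ v : TorusSite 2 L, relabel (Orb.translate v)
                (fermionEmbed (PolySite.toTorusEmb L (hInjw L hL)) wloc)) *
              hubbardTorusTT' L t t' U) *ᵥ ζ)).re / (L : ℝ) ^ 2 ≤
        -((expect (pairField g L) ζ).re / (L : ℝ) ^ 2))
    (ψ : ∀ L, Fock (Orb (FermionTorus 2 L)))
    (hψ : ∀ L, IsGroundStateInSector (hubbardTorusTT' L t t' U) (rectN n L) 0 (ψ L))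
    (hψ1 : ∀ L, star (ψ L) ⬝ᵥ ψ L = 1) :
    liminf (fun k : ℕ => (∑ x ∈ halfOpenBox 2 (2 * k), ∑ y ∈ halfOpenBox 2 (2 * k),
        torusPullback (pairFieldCorr g ψ) (2 * k) x y) / ((#(halfOpenBox 2 (2 * k)) : ℝ)) ^ 2) atTop ≤
      (c - A + (∑ σ : Fin 2, μ σ) * (n / 2 - ν)) ^ 2 := by
  obtain ⟨Cγ, Lγ, hCγ, hγ⟩ := exists_abs_re_expect_commutator_pairField_le g
  obtain ⟨Cα, Lα, hCα, hα⟩ := exists_eucNorm_pairField_conjTranspose_mulVec_le g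
  obtain ⟨Cκ, Lκ, hCκ, hκ'⟩ := exists_eucNorm_commutator_hubbardTorusTT'_pairField_conjTranspose_mulVec_le g t t' U
  -- the Hermitian parts of the eom word and their locality constants
  set O₁ : FermionOp Λw := (1 / 2 : ℂ) • (wloc + wlocᴴ) with hO₁
  set O₂ : FermionOp Λw := (I / 2 : ℂ) • (wlocᴴ - wloc) with hO₂
  have hNh : (totalNumberOp : FermionOp Λw).IsHermitian := by
    rw [totalNumberOp_eq_totalNumber]; exact totalNumber_isHermitian
  have hwN' : Commute totalNumberOp wlocᴴ := by
    have h1 := congrArg conjTranspose hwN.eq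
    rw [conjTranspose_mul, conjTranspose_mul, hNh.eq] at h1
    exact h1.symm
  have hO₁N : Commute totalNumberOp O₁ := (hwN.add_right hwN').smul_right _
  have hO₂N : Commute totalNumberOp O₂ := (hwN'.sub_right hwN).smul_right _
  obtain ⟨D₁, LD₁, hD₁, hDD₁⟩ := exists_norm_expect_doubleCommutator_sum_translate_le_TT'
    (mem_carEvenSubalgebra_univ_of_commute_totalNumberOp hO₁N) t t' U
  obtain ⟨D₂, LD₂, hD₂, hDD₂⟩ := exists_norm_expect_doubleCommutator_sum_translate_le_TT'
    (mem_carEvenSubalgebra_univ_of_commute_totalNumberOp hO₂N) t t' U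
  set M : ℝ := -(c - A + (∑ σ : Fin 2, μ σ) * (n / 2 - ν)) with hM
  have hM2 : (c - A + (∑ σ : Fin 2, μ σ) * (n / 2 - ν)) ^ 2 = M ^ 2 := by rw [hM, neg_sq]
  rw [hM2]
  set useq : ℕ → ℝ := fun k => (∑ x ∈ halfOpenBox 2 (2 * k), ∑ y ∈ halfOpenBox 2 (2 * k),
      torusPullback (pairFieldCorr g ψ) (2 * k) x y) / ((#(halfOpenBox 2 (2 * k)) : ℝ)) ^ 2 with huseq
  change liminf useq atTop ≤ M ^ 2
  set vseq : ℕ → ℝ := fun m =>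
    (expect ((pairField g (m + 1))ᴴ * pairField g (m + 1)) (ψ (m + 1))).re / (((m + 1 : ℕ) : ℝ)) ^ 4
    with hvseq
  have hterm : ∀ k : ℕ, 1 ≤ k → ∃ m : ℕ, 2 * k = m + 1 ∧ useq k = vseq m := by
    intro k hk
    obtain ⟨m, hm⟩ : ∃ m, 2 * k = m + 1 := ⟨2 * k - 1, by omega⟩
    refine ⟨m, hm, ?_⟩
    simp only [huseq, hvseq]
    rw [hm, torusLROSeq_pairFieldCorr_succ]
  have hvnonneg : ∀ m : ℕ, 0 ≤ vseq m := fun m => by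
    simp only [hvseq]
    refine div_nonneg ?_ (by positivity)
    exact (Complex.nonneg_iff.1
      ((Matrix.posSemidef_conjTranspose_mul_self (pairField g (m + 1))).dotProduct_mulVec_nonneg
        (ψ (m + 1)))).1
  have hnonneg : ∀ k : ℕ, 1 ≤ k → 0 ≤ useq k := fun k hk => by
    obtain ⟨m, -, heq⟩ := hterm k hk
    rw [heq]
    exact hvnonneg m
  have hbdd : IsBoundedUnder (· ≥ ·) atTop useq :=
    isBoundedUnder_of_eventually_ge (a := 0) (Filter.eventually_atTop.2 ⟨1, fun k hk => hnonneg k hk⟩)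
  by_contra hcon
  rw [not_le] at hcon
  obtain ⟨c₀, hc₀M, hc₀lim⟩ := exists_between hcon
  have hc₀ : 0 < c₀ := lt_of_le_of_lt (sq_nonneg M) hc₀M
  have hev : ∀ᶠ k : ℕ in atTop, c₀ < useq k := eventually_lt_of_lt_liminf hc₀lim hbdd
  -- the tower height: `(kt/(kt+1))·√c₀ > M`
  have hsqrt_pos : 0 < Real.sqrt c₀ := Real.sqrt_pos.2 hc₀
  have hMlt : M < Real.sqrt c₀ := by
    have h1 : |M| < Real.sqrt c₀ := by
      rw [← Real.sqrt_sq_eq_abs]; exact Real.sqrt_lt_sqrt (sq_nonneg M) hc₀M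
    exact lt_of_le_of_lt (le_abs_self M) h1
  obtain ⟨kt, hkt⟩ : ∃ kt : ℕ, M < (kt : ℝ) / (kt + 1) * Real.sqrt c₀ := by
    set δ : ℝ := 1 - M / Real.sqrt c₀ with hδ
    have hδpos : 0 < δ := by
      rw [hδ, sub_pos, div_lt_one hsqrt_pos]; exact hMlt
    obtain ⟨kt, hkt⟩ := exists_nat_gt (1 / δ)
    refine ⟨kt, ?_⟩
    have hk1 : (0 : ℝ) < kt + 1 := by positivity
    have h1 : 1 / ((kt : ℝ) + 1) < δ := by
      rw [div_lt_iff₀ hk1]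
      have : 1 / δ * δ = 1 := by field_simp
      nlinarith [hkt, hδpos]
    have h2 : (kt : ℝ) / (kt + 1) = 1 - 1 / (kt + 1) := by field_simp; ring
    rw [h2]
    have h3 : M / Real.sqrt c₀ < 1 - 1 / ((kt : ℝ) + 1) := by rw [hδ] at h1; linarith
    have := (div_lt_iff₀ hsqrt_pos).1 h3
    linarith
  set Dbar : ℝ := (Cκ / Real.sqrt (c₀ / 2)) * ∑ i ∈ Finset.range kt, (Cα / Real.sqrt (c₀ / 2)) ^ i with hDbar
  set K : ℝ := -(∑ σ : Fin 2, μ σ) * kt / 2 + κ * Dbar with hK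
  -- the floor constant: `kt` pairs at cost `8 K₁₈ / n` each
  set K18 : ℝ := 18 * (2 * |t| + |U| + 2 * |t'|) with hK18
  have hK18nn : 0 ≤ K18 := by positivity
  set Cfl : ℝ := kt * (2 * (K18 * (4 / n))) with hCfl
  have hCfl0 : 0 ≤ Cfl := by positivity
  set ε₀ : ℝ := Dbar + Cfl with hε₀
  set Sl : ℝ := Real.sqrt (2 * ε₀ * D₁) + Real.sqrt (2 * ε₀ * D₂) with hSl
  obtain ⟨L₂, hL₂⟩ : ∃ L₂ : ℕ, ∀ L : ℕ, L₂ ≤ L → ((kt : ℝ) + 1) * Cγ ≤ (c₀ / 2) * (L : ℝ) ^ 2 := by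
    obtain ⟨L₂, hL₂⟩ := exists_nat_ge (((kt : ℝ) + 1) * Cγ / (c₀ / 2))
    refine ⟨max L₂ 1, fun L hL => ?_⟩
    have hL1 : (1 : ℝ) ≤ L := by exact_mod_cast le_trans (le_max_right _ _) hL
    have hLL : (L₂ : ℝ) ≤ L := by exact_mod_cast le_trans (le_max_left _ _) hL
    have hc2 : 0 < c₀ / 2 := by linarith
    have h1 : ((kt : ℝ) + 1) * Cγ ≤ (c₀ / 2) * L := by
      rw [div_le_iff₀ hc2] at hL₂
      calc ((kt : ℝ) + 1) * Cγ ≤ (L₂ : ℝ) * (c₀ / 2) := hL₂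
        _ ≤ (L : ℝ) * (c₀ / 2) := mul_le_mul_of_nonneg_right hLL hc2.le
        _ = (c₀ / 2) * L := mul_comm _ _
    have h2 : (c₀ / 2) * (L : ℝ) ≤ (c₀ / 2) * (L : ℝ) ^ 2 := by
      have : (L : ℝ) ≤ (L : ℝ) ^ 2 := le_self_pow₀ hL1 two_ne_zero
      exact mul_le_mul_of_nonneg_left this hc2.le
    linarith
  -- the sides from which the sectors `N + 2m`, `m ≤ kt`, fit and the floor constant applies
  obtain ⟨L₃, hL₃⟩ : ∃ L₃ : ℕ, ∀ L : ℕ, L₃ ≤ L →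
      (2 : ℝ) ≤ n * (L : ℝ) ^ 2 ∧ n * (L : ℝ) ^ 2 + 2 * kt ≤ 2 * (L : ℝ) ^ 2 := by
    obtain ⟨L₃, hL₃⟩ := exists_nat_ge (max (2 / n) (2 * kt / (2 - n)))
    refine ⟨max L₃ 1, fun L hL => ?_⟩
    have hL1 : (1 : ℝ) ≤ L := by exact_mod_cast le_trans (le_max_right _ _) hL
    have hLL : (L₃ : ℝ) ≤ L := by exact_mod_cast le_trans (le_max_left _ _) hL
    have hLsq : (L : ℝ) ≤ (L : ℝ) ^ 2 := le_self_pow₀ hL1 two_ne_zero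
    have h2n : (0 : ℝ) < 2 - n := by linarith
    have ha : 2 / n ≤ (L : ℝ) := le_trans (le_trans (le_max_left _ _) hL₃) hLL
    have hb : 2 * kt / (2 - n) ≤ (L : ℝ) := le_trans (le_trans (le_max_right _ _) hL₃) hLL
    rw [div_le_iff₀ hn0] at ha
    rw [div_le_iff₀ h2n] at hb
    have ha' : (L : ℝ) * n ≤ (L : ℝ) ^ 2 * n := mul_le_mul_of_nonneg_right hLsq hn0.le
    have hb' : (L : ℝ) * (2 - n) ≤ (L : ℝ) ^ 2 * (2 - n) := mul_le_mul_of_nonneg_right hLsq h2n.le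
    constructor
    · linarith
    · linarith
  set Lr : ℕ → ℝ := fun k => ((2 * k : ℕ) : ℝ) with hLr
  set Eseq : ℕ → ℝ := fun k =>
    groundEnergy (hubbardTorusTT' (2 * k) t t' U) (rectN n (2 * k)) / ((2 * k : ℕ) : ℝ) ^ 2 with hEseq
  set Nseq : ℕ → ℝ := fun k => (rectN n (2 * k) : ℝ) / ((2 * k : ℕ) : ℝ) ^ 2 with hNseq
  set lhs : ℕ → ℝ := fun k => (kt : ℝ) / (kt + 1) * Real.sqrt (c₀ - (kt + 1) * Cγ / Lr k ^ 2) with hlhs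
  set rhs : ℕ → ℝ := fun k =>
    -(c - A + (∑ σ : Fin 2, μ σ) * (Nseq k / 2 - ν) + κ * (u - Eseq k)) + K / Lr k ^ 2 + Sl / Lr k with hrhs
  -- the finite-volume tower step, eventually in `k`
  have hstep : ∀ᶠ k : ℕ in atTop, lhs k ≤ rhs k := by
    filter_upwards [hev, Filter.eventually_ge_atTop
      (max 1 (max L₁ (max Lγ (max Lα (max Lκ (max L₂ (max L₃ (max LD₁ LD₂))))))))] with k hk hkL
    have hk1 : 1 ≤ k := le_trans (le_max_left _ _) hkL
    obtain ⟨m, hm, heq⟩ := hterm k hk1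
    simp only [max_le_iff] at hkL
    obtain ⟨-, hkL₁, hkγ, hkα, hkκ, hk₂, hk₃, hkD₁, hkD₂⟩ := hkL
    have hmL₁ : L₁ ≤ m + 1 := by omega
    have hmγ : Lγ ≤ m + 1 := by omega
    have hmα : Lα ≤ m + 1 := by omega
    have hmκ : Lκ ≤ m + 1 := by omega
    have hm₂ : L₂ ≤ m + 1 := by omega
    have hm₃ : L₃ ≤ m + 1 := by omega
    have hmD₁ : LD₁ ≤ m + 1 := by omega
    have hmD₂ : LD₂ ≤ m + 1 := by omega
    set L' : ℕ := m + 1 with hL'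
    set H := hubbardTorusTT' L' t t' U with hH
    set N : ℕ := rectN n L' with hNdef
    have hL'pos : (0 : ℝ) < (L' : ℝ) := by positivity
    have hlro : c₀ * (((L' : ℕ) : ℝ)) ^ 4 ≤ (expect ((pairField g L')ᴴ * pairField g L') (ψ L')).re := by
      have h := hk.le
      rw [heq] at h
      simp only [hvseq] at h
      rwa [le_div_iff₀ (by positivity)] at h
    -- the eom operator and its Hermitian parts on the torus of side `L'`
    obtain ⟨hB₁h, hB₂h, hB₁N, hB₂N, hWB⟩ := eom_translationSum_decomposition (hInjw L' hmL₁) wloc hwN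
    -- the double-commutator bounds, in the `[B,[B,H]]` orientation
    have hflip : ∀ (B : Matrix (Finset (Orb (FermionTorus 2 L'))) (Finset (Orb (FermionTorus 2 L'))) ℂ) {D : ℝ},
        (∀ χ : Fock (Orb (FermionTorus 2 L')), star χ ⬝ᵥ χ = 1 →
          ‖expect (B * (H * B - B * H) - (H * B - B * H) * B) χ‖ ≤ D * (L' : ℝ) ^ 2) →
        ∀ χ : Fock (Orb (FermionTorus 2 L')), star χ ⬝ᵥ χ = 1 →
          |(star χ ⬝ᵥ ((B * (B * H - H * B) - (B * H - H * B) * B) *ᵥ χ)).re| ≤ D * (L' : ℝ) ^ 2 := by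
      intro B D hB χ hχ
      have e : B * (B * H - H * B) - (B * H - H * B) * B = -(B * (H * B - B * H) - (H * B - B * H) * B) := by
        simp only [Matrix.mul_sub, Matrix.sub_mul, neg_sub]
        abel
      rw [e, neg_mulVec, dotProduct_neg, Complex.neg_re, abs_neg]
      exact (Complex.abs_re_le_norm _).trans (hB χ hχ)
    have hDD₁' := hflip _ (hDD₁ L' hmD₁ (hInjw L' hmL₁))
    have hDD₂' := hflip _ (hDD₂ L' hmD₂ (hInjw L' hmL₁))
    -- the sector floor
    have hcard : ⌊n * (((L' : ℕ)) : ℝ) ^ 2 / 2⌋₊ ≤ Fintype.card (FermionTorus 2 L') := by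
      rw [show Fintype.card (FermionTorus 2 L') = L' ^ 2 by simp]
      have h2 := rectN_le_two_mul hn0.le hn2.le L'
      simp only [rectN] at h2
      have e : L' ^ 2 = L' * L' := by ring
      rw [e]
      exact Nat.le_of_mul_le_mul_left h2 (by norm_num)
    have hE : H.minEnergyOn (szSector N 0) = groundEnergy H N := by
      simp only [hNdef, rectN]
      rw [groundEnergy_hubbardTorusTT'_eq_minEnergyOn_szSector L' t t' U hcard]
    obtain ⟨hnL, hfit⟩ := hL₃ L' hm₃
    have hNlow : n * (L' : ℝ) ^ 2 - 2 < (N : ℝ) := by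
      have := lt_rectN_add_two n L'; rw [← hNdef] at this; linarith only [this]
    have hNup : (N : ℝ) ≤ n * (L' : ℝ) ^ 2 := by rw [hNdef]; exact rectN_le hn0.le L'
    have hfl : ∀ m' : ℕ, m' ≤ kt → ∀ χ : Fock (Orb (FermionTorus 2 L')), star χ ⬝ᵥ χ = 1 →
        totalNumber *ᵥ χ = (((N : ℝ) + 2 * (m' : ℝ) : ℝ) : ℂ) • χ →
        H.minEnergyOn (szSector N 0) - Cfl ≤ (star χ ⬝ᵥ (H *ᵥ χ)).re := by
      intro m' hm' χ hχ1 hχN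
      have hfit' : N + 2 * m' ≤ 2 * L' ^ 2 := by
        have h1 : ((N : ℝ) + 2 * (m' : ℝ)) ≤ 2 * (L' : ℝ) ^ 2 := by
          have : (m' : ℝ) ≤ kt := by exact_mod_cast hm'
          linarith only [this, hfit, hNup]
        exact_mod_cast h1
      have hrem := groundEnergy_hubbardTorusTT'_le_add_pairs L' t t' U (N := N) (m := m') hfit'
      rw [← hK18, ← hH] at hrem
      -- the cost per pair is at most `2 K18 (4/n)`
      have hNp1 : (0 : ℝ) < (N : ℝ) + 1 := by positivity
      have hratio : 2 * (L' : ℝ) ^ 2 / ((N : ℝ) + 1) ≤ 4 / n := by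
        rw [div_le_div_iff₀ hNp1 hn0]
        linarith only [hNlow, hnL]
      have hcost : (m' : ℝ) * (2 * (K18 * (2 * (L' : ℝ) ^ 2) / ((N : ℝ) + 1))) ≤ Cfl := by
        rw [hCfl]
        have h1 : K18 * (2 * (L' : ℝ) ^ 2) / ((N : ℝ) + 1) ≤ K18 * (4 / n) := by
          rw [mul_div_assoc]; exact mul_le_mul_of_nonneg_left hratio hK18nn
        have h2 : (m' : ℝ) ≤ kt := by exact_mod_cast hm'
        have h3 : 0 ≤ 2 * (K18 * (2 * (L' : ℝ) ^ 2) / ((N : ℝ) + 1)) := by positivity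
        calc (m' : ℝ) * (2 * (K18 * (2 * (L' : ℝ) ^ 2) / ((N : ℝ) + 1)))
            ≤ kt * (2 * (K18 * (2 * (L' : ℝ) ^ 2) / ((N : ℝ) + 1))) := mul_le_mul_of_nonneg_right h2 h3
          _ ≤ kt * (2 * (K18 * (4 / n))) := by
              exact mul_le_mul_of_nonneg_left (by linarith) (by positivity)
      -- the variational floor of the sector `N + 2m'`
      have hcast : (((N : ℝ) + 2 * (m' : ℝ) : ℝ) : ℂ) = ((N + 2 * m' : ℕ) : ℂ) := by
        rw [Complex.ofReal_add, Complex.ofReal_mul, Complex.ofReal_natCast, Complex.ofReal_natCast,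
          Complex.ofReal_ofNat, Nat.cast_add, Nat.cast_mul, Nat.cast_ofNat]
      have hχN' : IsNParticle (N + 2 * m') χ := by
        rw [LiebTwo.isNParticle_iff_totalNumber, hχN, hcast]
      have hvar : groundEnergy H (N + 2 * m') ≤ (star χ ⬝ᵥ (H *ᵥ χ)).re :=
        groundEnergy_le_re_expect H hχN' hχ1
      rw [hE]
      linarith only [hrem, hcost, hvar]
    -- the tower step on the torus of side `L'`
    have h := tower_finite_step_S g t t' U (hψ1 L') (hψ L') μ hκ hc₀ hCα hCκ hCγ kt
      (hα L' hmα) (hκ' L' hmκ) (hγ L' hmγ) hlro (hL₂ L' hm₂) _ _ _ hB₁h hB₂h hB₁N hB₂N hWB hD₁ hD₂ hCfl0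
      hDD₁' hDD₂' hfl (hboundS L' hmL₁)
    rw [hE, ← hDbar, ← hK, ← hε₀, ← hSl] at h
    have e1 : ((rectN n L' : ℕ) : ℝ) / 2 / (((L' : ℕ) : ℝ)) ^ 2 =
        ((rectN n L' : ℕ) : ℝ) / (((L' : ℕ) : ℝ)) ^ 2 / 2 := div_right_comm _ _ _
    rw [e1] at h
    simp only [hlhs, hrhs, hLr, hNseq, hEseq]
    rw [hm]
    exact h
  have h2k : Tendsto (fun k : ℕ => 2 * k) atTop atTop := Filter.tendsto_id.const_mul_atTop' (by norm_num)
  have hLr_top : Tendsto Lr atTop atTop := tendsto_natCast_atTop_atTop.comp h2k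
  have hLr1 : Tendsto (fun k => (Lr k)⁻¹) atTop (𝓝 0) := hLr_top.inv_tendsto_atTop
  have hLr2 : Tendsto (fun k => (Lr k ^ 2)⁻¹) atTop (𝓝 0) :=
    ((tendsto_pow_atTop (α := ℝ) two_ne_zero).comp hLr_top).inv_tendsto_atTop
  have hlhs_lim : Tendsto lhs atTop (𝓝 ((kt : ℝ) / (kt + 1) * Real.sqrt c₀)) := by
    have h1 : Tendsto (fun k => c₀ - (kt + 1) * Cγ * (Lr k ^ 2)⁻¹) atTop (𝓝 (c₀ - (kt + 1) * Cγ * 0)) :=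
      tendsto_const_nhds.sub (hLr2.const_mul _)
    rw [mul_zero, sub_zero] at h1
    have h2 := (h1.sqrt).const_mul ((kt : ℝ) / (kt + 1))
    refine h2.congr' (Eventually.of_forall fun k => ?_)
    simp [hlhs, div_eq_mul_inv, mul_assoc]
  have hE_lim : Tendsto Eseq atTop (𝓝 (energyDensityTT' t t' U n)) :=
    (tendsto_energyDensityTT'_torus t t' hU hn0.le hn2).comp h2k
  have hN_lim : Tendsto Nseq atTop (𝓝 n) := (tendsto_rectN_div_sq hn0.le).comp h2k
  have hrhs_lim : Tendsto rhs atTop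
      (𝓝 (-(c - A + (∑ σ : Fin 2, μ σ) * (n / 2 - ν) + κ * (u - energyDensityTT' t t' U n)) + K * 0 + Sl * 0)) := by
    have h1 : Tendsto (fun k => -(c - A + (∑ σ : Fin 2, μ σ) * (Nseq k / 2 - ν) + κ * (u - Eseq k)))
        atTop (𝓝 (-(c - A + (∑ σ : Fin 2, μ σ) * (n / 2 - ν) + κ * (u - energyDensityTT' t t' U n)))) :=
      ((tendsto_const_nhds.add (((hN_lim.div_const 2).sub tendsto_const_nhds).const_mul _)).add
        ((tendsto_const_nhds.sub hE_lim).const_mul κ)).neg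
    have h2 := (h1.add (hLr2.const_mul K)).add (hLr1.const_mul Sl)
    refine h2.congr' (Eventually.of_forall fun k => ?_)
    simp [hrhs, div_eq_mul_inv]
  have hle := le_of_tendsto_of_tendsto hlhs_lim hrhs_lim hstep
  rw [mul_zero, mul_zero, add_zero, add_zero] at hle
  have hslack : 0 ≤ κ * (u - energyDensityTT' t t' U n) := mul_nonneg hκ (sub_nonneg.2 hu)
  have : (kt : ℝ) / (kt + 1) * Real.sqrt c₀ ≤ M := by linarith [hM, hle, hslack]
  linarith

end Family

end Summit.Ventures.CertifiedManyBodySolver.Observables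

end
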